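import Literature.Analysis.PDE.HarmonicMapMinimisers
import Mathlib.MeasureTheory.Measure.Lebesgue.EqHaar
import HarnessLib

/-!
# Crux `BlockLipschitzL` (stmt-QuantumFields-23533) ∕ `HistoryTailL` (stmt-QuantumFields-19936), LINE 25 «CompactnessTransfer»,
# (C)-PROOF brick (C-e) LETTERS «LIMSUP∕LIMINF BOOKKEEPING AND SHRINKING BALLS FOR THE COMPACTNESS KNIT»

Cell `ym3-torus` (YM ladder rung R3 = continuum SU(2) Yang–Mills on T³ — a RUNG, NOT the Clay problem: not d = 4, not
infinite volume, not a mass gap); WIDTH helper seat `ym-ust-19936-w2` g13, (C)-PROOF lineage project (LEAD GO 13:49Z):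
`MinimisingMapCompactness_holds` by Hardt–Kinderlehrer–Lin.  Helper `--supports stmt-QuantumFields-23533`; THEOREMS ONLY
(0 `def`, 0 `sorry`, default heartbeats); imports the lit def file ✓`HarmonicMapMinimisers` + Mathlib.

WHAT THIS FILE DOES.  Two filter-free letters for the knit (C-e) of lit `Literature.Analysis.PDE.MinimisingMapCompactness`:
(§1) a real sequence `a` converges to `L` as soon as (lsc) `L ≤ M` whenever `a j ≤ M` for infinitely many `j`, and (usc)
for every `ε > 0` eventually `a j ≤ L + ε` (`tendsto_of_lsc_of_eventually_le`); (§2) for a nonnegative function integrable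
on an open set containing a closed ball of `ℝ³`, the integrals over the concentric open balls of radius `t ↓ ρ` decrease
to the integral over the open ball of radius `ρ` (spheres are Lebesgue-null), in the `ε`-form the knit consumes
(`exists_radius_setIntegral_ball_le_add`).

HONEST SCOPE.  Bookkeeping; nothing of (C), (RS), S1″, S2♭″, `BlockLipschitzL`, `HistoryTailL` is proved here.  YM₃ on
T³ is rung R3, not Clay; YM gap NOT proved.

References: L. Simon, Theorems on Regularity and Singularity of Energy Minimizing Maps (1996) [Simon1996] (§2.9 Lemma 1,
the compactness lemma this serves); R. Hardt, D. Kinderlehrer, F.-H. Lin, Comm. Math. Phys. 105 (1986) [HardtKinderlehrerLin1986] (§2).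
-/

set_option autoImplicit false

noncomputable section

open MeasureTheory Set Filter Topology Metric

namespace Summit.QuantumFields.YangMills.Theorems.PoincareLipschitzMinimisingMapCompactnessLetters

/-! ## §1 Convergence from lower semicontinuity and an eventual upper bound -/

/-- **Convergence from (lsc) + (eventual usc)**: if `L ≤ M` whenever `a j ≤ M` frequently, and for every `ε > 0`
eventually `a j ≤ L + ε`, then `a j → L`. [folklore] -/
theorem tendsto_of_lsc_of_eventually_le {a : ℕ → ℝ} {L : ℝ}
    (hlsc : ∀ M : ℝ, (∃ᶠ j in atTop, a j ≤ M) → L ≤ M)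
    (husc : ∀ ε : ℝ, 0 < ε → ∀ᶠ j in atTop, a j ≤ L + ε) :
    Tendsto a atTop (𝓝 L) := by
  rw [Metric.tendsto_atTop]
  intro ε hε
  have h1 : ∀ᶠ j in atTop, L - ε / 2 < a j := by
    by_contra hcon
    rw [not_eventually] at hcon
    have h2 : ∃ᶠ j in atTop, a j ≤ L - ε / 2 := hcon.mono fun j hj => not_lt.1 hj
    have := hlsc _ h2
    linarith
  obtain ⟨N, hN⟩ := eventually_atTop.1 (h1.and (husc (ε / 2) (half_pos hε)))
  refine ⟨N, fun j hj => ?_⟩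
  obtain ⟨hl, hu⟩ := hN j hj
  rw [Real.dist_eq, abs_lt]
  constructor <;> linarith

/-- **Eventual upper bound from an `ε/3`-budget**: bookkeeping form used by the knit. [folklore] -/
theorem eventually_le_add_of_three {a b : ℕ → ℝ} {L A B ε : ℝ} (hε : 0 < ε)
    (hab : ∀ j, a j ≤ A + B + b j) (hA : A ≤ L + ε / 3) (hB : B ≤ ε / 3)
    (hb : Tendsto b atTop (𝓝 0)) : ∀ᶠ j in atTop, a j ≤ L + ε := by
  have h1 : ∀ᶠ j in atTop, b j < ε / 3 := (tendsto_order.1 hb).2 _ (by linarith)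
  filter_upwards [h1] with j hj
  linarith [hab j]

/-! ## §2 Shrinking concentric balls -/

/-- Spheres are Lebesgue-null in `ℝ³`, so the closed and the open ball carry the same integral. [folklore] -/
theorem setIntegral_closedBall_eq_ball (f : EuclideanSpace ℝ (Fin 3) → ℝ) (y : EuclideanSpace ℝ (Fin 3)) (ρ : ℝ) :
    ∫ x in closedBall y ρ, f x = ∫ x in ball y ρ, f x := by
  refine setIntegral_congr_set ((ae_eq_set).2 ⟨?_, ?_⟩)
  · rw [closedBall_sdiff_ball]
    exact Measure.addHaar_sphere volume y ρ
  · rw [sdiff_eq_empty.2 ball_subset_closedBall, measure_empty]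

/-- **Integrals over `ball y t`, `t ↓ ρ`, converge to the integral over `ball y ρ`** (for `f` integrable on
`ball y (ρ + δ)`, along the radii `ρ + δ/(n+1)`). [folklore] -/
theorem tendsto_setIntegral_ball_shrink {f : EuclideanSpace ℝ (Fin 3) → ℝ} {y : EuclideanSpace ℝ (Fin 3)} {ρ δ : ℝ}
    (hδ : 0 < δ) (hf : IntegrableOn f (ball y (ρ + δ)) volume) :
    Tendsto (fun n : ℕ => ∫ x in ball y (ρ + δ * (1 / ((n : ℝ) + 1))), f x) atTop (𝓝 (∫ x in ball y ρ, f x)) := by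
  have hanti : Antitone fun n : ℕ => ball y (ρ + δ * (1 / ((n : ℝ) + 1))) := by
    intro m n hmn
    refine ball_subset_ball (add_le_add le_rfl (mul_le_mul_of_nonneg_left ?_ hδ.le))
    exact one_div_le_one_div_of_le (by positivity) (by
      have : (m : ℝ) ≤ n := by exact_mod_cast hmn
      linarith)
  have hInter : (⋂ n : ℕ, ball y (ρ + δ * (1 / ((n : ℝ) + 1)))) = closedBall y ρ := by
    ext x
    simp only [mem_iInter, mem_ball, mem_closedBall]
    constructor
    · intro h
      by_contra hx
      push Not at hx
      obtain ⟨n, hn⟩ := exists_nat_gt (δ / (dist x y - ρ))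
      have hn1 : δ / (dist x y - ρ) < (n : ℝ) + 1 := by linarith
      have hpos : 0 < dist x y - ρ := sub_pos.2 hx
      have h2 : δ * (1 / ((n : ℝ) + 1)) < dist x y - ρ := by
        rw [div_lt_iff₀ hpos] at hn1
        rw [← mul_div_assoc, mul_one, div_lt_iff₀ (by positivity : (0:ℝ) < (n : ℝ) + 1)]
        linarith
      have := h n
      linarith
    · intro h n
      have : (0 : ℝ) < δ * (1 / ((n : ℝ) + 1)) := by positivity
      linarith
  have h0 : IntegrableOn f (ball y (ρ + δ * (1 / (((0 : ℕ) : ℝ) + 1)))) volume := by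
    refine hf.mono_set (ball_subset_ball ?_)
    norm_num
  have h := tendsto_setIntegral_of_antitone (μ := volume) (fun n => measurableSet_ball) hanti ⟨0, h0⟩
  rw [hInter, setIntegral_closedBall_eq_ball] at h
  exact h

/-- **The `ε`-form**: for `f` integrable on `ball y (ρ + δ)` and `ε > 0` there is a radius `t ∈ (ρ, ρ + δ)` with
`∫_{ball y t} f ≤ ∫_{ball y ρ} f + ε`. [folklore] -/
theorem exists_radius_setIntegral_ball_le_add {f : EuclideanSpace ℝ (Fin 3) → ℝ} {y : EuclideanSpace ℝ (Fin 3)}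
    {ρ δ ε : ℝ} (hδ : 0 < δ) (hε : 0 < ε) (hf : IntegrableOn f (ball y (ρ + δ)) volume) :
    ∃ t : ℝ, ρ < t ∧ t < ρ + δ ∧ ∫ x in ball y t, f x ≤ (∫ x in ball y ρ, f x) + ε := by
  have h1 : ∀ᶠ n : ℕ in atTop, ∫ x in ball y (ρ + δ * (1 / ((n : ℝ) + 1))), f x < (∫ x in ball y ρ, f x) + ε :=
    (tendsto_order.1 (tendsto_setIntegral_ball_shrink hδ hf)).2 _ (by linarith)
  have h2 : ∀ᶠ n : ℕ in atTop, δ * (1 / ((n : ℝ) + 1)) < δ := by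
    have ht : Tendsto (fun n : ℕ => δ * (1 / ((n : ℝ) + 1))) atTop (𝓝 (δ * 0)) :=
      tendsto_one_div_add_atTop_nhds_zero_nat.const_mul δ
    rw [mul_zero] at ht
    exact (tendsto_order.1 ht).2 _ hδ
  obtain ⟨n, hn1, hn2⟩ := (h1.and h2).exists
  exact ⟨ρ + δ * (1 / ((n : ℝ) + 1)), by linarith [show (0 : ℝ) < δ * (1 / ((n : ℝ) + 1)) by positivity],
    by linarith, hn1.le⟩

end Summit.QuantumFields.YangMills.Theorems.PoincareLipschitzMinimisingMapCompactnessLetters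

end
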